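import Summits.ResolutionOfSingularities.ResolutionOfSingularities.Theorems.EquisingularLiftEquisingularLiftBlowupModelFour
import Summits.ResolutionOfSingularities.ResolutionOfSingularities.Theorems.CossartPiltant2019PrincipalizationHolds
import Literature.AlgebraicGeometry.CossartPiltant200819.Thm21Verbatim2008
import Literature.AlgebraicGeometry.CossartPiltant200819.GoodResolution2019
import Mathlib.RingTheory.Kaehler.Basic
import HarnessLib

/-!
# Crux `EquisingularLift` (stmt-ResolutionOfSingularities-15660), line `Sketch` (skeleton v10c `f3e6993bf39ec5c9`):
# the `n = 4` leaf and the stub `stub_CP2019General` — dependence REDUCED to Cossart–Piltant 2008/2009 (threefolds over a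
# field) or to the single fact CP 2019 Thm. 1.1, with Prop. 4.4 (principalization) DISCHARGED

[OURS · leafhand-res-equisingularlift-1 g1, 2026-08-31] AI-produced, weaker than expert review; NOT a statement of any
manuscript; nothing here proves resolution of singularities in positive characteristic.

The registered stub `stub_CP2019General : CossartPiltant2019General.{0}` (Cossart–Piltant 2019 Thm. 1.1 (i)(ii) for ALL
reduced separated quasi-excellent Noetherian schemes of dimension `≤ 3`) enters the line only through the `n = 4` leaf
`stub_blowupModel_four` (regular projective blow-up models of integral threefold hypersurfaces `H ⊆ ℙ⁴_k`, `k = k̄` of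
characteristic `p`), proved in the tree as `stub_blowupModel_four_of_CP hCP hPr` from Thm. 1.1 AND Prop. 4.4.  Since then
Prop. 4.4 was DISCHARGED (`CP2008Prop44.CossartPiltant2019Principalization_holds`, 2026-08-28).  This file records:

* `admitsDesingularization_of_isResolution_dim_three` — the Raynaud–Gruson / principalization engine of
  `Picover.KernelReduction.admitsDesingularization_of_dim_three` with Cossart–Piltant Thm. 1.1 replaced by ITS OUTPUT AT THE
  ONE SCHEME `S`: any resolution `π : X'' → S` of an integral threefold `S` (separated, of finite type over an excellent
  ring) which is an isomorphism over `Reg S` yields ONE `Sing S`-supported blow-up with regular source (Stacks 081T + 080E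
  domination, CP 2019 Prop. 4.4 on the regular excellent threefold `X''`, Stacks 080A/080B) — Prop. 4.4 still a binder here,
  discharged at the use sites;
* `isDifferentiallyFinite_of_perfectField` — a perfect field is differentially finite over itself (`Ω_{k/k} = 0`), so the
  VERBATIM Cossart–Piltant 2008 Thm. 2.1 / 2009 "Theorem" (`CP2008.ResolutionQuasiProjectiveThreefolds`: reduced
  quasi-projective threefolds over differentially finite fields of characteristic `p > 0`) applies over `k = k̄`;
* `exists_isResolution_of_resolutionQuasiProjectiveThreefolds_of_isClosedImmersion` — its output for a reduced closed
  `H ⊆ ℙⁿ_k` of dimension `3`: a resolution which is an isomorphism over `Reg H` (birational by the SNC clause (iii),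
  exactly as the tree's affine rendering `CP2008.exists_isResolution_of_resolutionQuasiProjectiveThreefolds`);
* `stub_blowupModel_four_of_CP2008` — **the `n = 4` leaf CONDITIONAL on `CP2008.ResolutionQuasiProjectiveThreefolds.{0}`
  alone** (the printed theorem that actually covers hypersurfaces over `k̄`; strictly weaker input than CP 2019 Thm. 1.1,
  cf. `CP2019.CossartPiltant2019Thm11.cp2008_of_thm11`; its own printed-leaves decomposition is
  `CP2008.resolutionQuasiProjectiveThreefolds_of_printedLeaves_residuals₀`, whose leaf [36] = `CossartJannsenSaito2020Sequence`
  is reduced to `CossartJannsenSaito2020_sigmaMaxElimination` by the sibling file `…CJS2020SequenceOfSigmaMax`);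
* `stub_blowupModel_four_of_CP2019General` — the `n = 4` leaf CONDITIONAL on `CossartPiltant2019General.{0}` ALONE
  (Prop. 4.4 folded in), and `stub_blowupModel_four_of_CP2019Thm11` — on the single port fact `CP2019.CossartPiltant2019Thm11`
  (`CossartPiltant2019Thm11.general`).

After the one fact binder each `stub_blowupModel_four_of_…` has the registered `stub_blowupModel_four` signature verbatim.
Honest label: `stub_CP2019General` is NOT closed; the line's `n = 4` leaf now needs ONE named fact (either of two printed
theorems) instead of two.

References: [CossartPiltant2008, Thm. 2.1 (HAL p. 3)]; [CossartPiltant2009, Theorem (p. 1839)]; [CossartPiltant2019,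
Thm. 1.1, Prop. 4.4]; [StacksProject, Tags 081T, 080E, 080A, 080B]; [Temkin2008, Def. 2.2.6].
-/

set_option linter.dupNamespace false -- mandated namespace `Summit.<Summit>.<Problem>` of this single-conjunct summit

noncomputable section

open CategoryTheory CategoryTheory.Limits AlgebraicGeometry TopologicalSpace Topology IsLocalRing
open Literature.AlgebraicGeometry.Resolution Literature.AlgebraicGeometry.Motives Literature.AlgebraicGeometry.Morphisms
open Summit.ResolutionOfSingularities.ResolutionOfSingularities.Theorems.Picover.LocalBlowups
open Literature.AlgebraicGeometry.CossartPiltant200819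

universe u

namespace Summit.ResolutionOfSingularities.ResolutionOfSingularities.Cruxes.EquisingularLift.StrataSplit

/-! ## The Raynaud–Gruson / principalization engine, with the resolution as input -/

/-- **One `Sing S`-supported blow-up with regular source from ANY resolution which is an isomorphism over `Reg S`**
(integral threefold `S`, separated of finite type over an excellent ring `R`), modulo Cossart–Piltant 2019 Prop. 4.4:
Raynaud–Gruson (`exists_isBlowup_dominating`: Stacks 081T + 080E) gives the `U`-admissible blow-up `b : S₁ → S` along `I`
(`Supp I = Sing S`) dominating `X''` by a blow-up `r : S₁ → X''` along `I𝒪_{X''} ≠ 0`; `X''` is a regular excellent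
integral threefold, so Prop. 4.4 principalizes `I𝒪_{X''}` by one `V(I𝒪_{X''})`-supported blow-up `σ : X_r → X''` with
regular source (`formatPrincipalization_dim3_of_cossartPiltant`); `σ` factors through `r` by a blow-up `t`
(`exists_isBlowup_factor`, Stacks 080A) and `t ≫ b` is a `Sing S`-supported blow-up (Stacks 080B).  This is
`Picover.KernelReduction.admitsDesingularization_of_dim_three` with its Step 1 (CP Thm. 1.1) turned into a hypothesis.
[cite: CossartPiltant2019, Prop. 4.4] [cite: StacksProject, Tag 081T; Tag 080E; Tag 080A; Tag 080B] -/
theorem admitsDesingularization_of_isResolution_dim_three (hPr : CossartPiltant2019Principalization.{u})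
    {R : Type u} [CommRing R] (hR : IsExcellentRing R) (S : Scheme.{u}) [IsIntegral S] (q : S ⟶ Spec (.of R))
    [IsSeparated q] [LocallyOfFiniteType q] [QuasiCompact q] (hdim : topologicalKrullDim S = 3)
    {X'' : Scheme.{u}} (π : X'' ⟶ S) (hπ : IsResolution π) (U : S.Opens)
    (hU : (U : Set S) = Scheme.regularLocus S) [IsIso (π ∣_ U)] : Scheme.AdmitsDesingularization S := by
  classical
  haveI : IsNoetherianRing (CommRingCat.of R) := hR.isQuasiExcellentRing.isNoetherianRing
  haveI : IsLocallyNoetherian S := LocallyOfFiniteType.isLocallyNoetherian q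
  haveI : CompactSpace S := QuasiCompact.compactSpace_of_compactSpace q
  haveI : IsNoetherian S := {}
  haveI : S.IsSeparated := ⟨by rw [← terminal.comp_from q]; infer_instance⟩
  haveI : IsProper π := hπ.isProper
  -- Raynaud–Gruson (Stacks 081T + 080E): `b : S₁ → S` blow-up along `I`, `Supp I = Sing S`,
  -- dominating `X''` by a blow-up `r : S₁ → X''` along `I.comap π`
  obtain ⟨I, S₁, b, r, -, hIsupp, hb, hrb, hr⟩ :=
    exists_isBlowup_dominating π U (TopologicalSpace.NoetherianSpace.isCompact _)
  -- Cossart–Piltant 2019, Prop. 4.4 on the regular excellent threefold `X''`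
  haveI : IsLocallyNoetherian X'' := LocallyOfFiniteType.isLocallyNoetherian π
  haveI : CompactSpace X'' := QuasiCompact.compactSpace_of_compactSpace π
  haveI : IsNoetherian X'' := {}
  haveI : IsReduced X'' := hπ.isRegular.isReduced
  haveI : IsIntegral X'' := hπ.isBirational.isIntegral
  have hexc : Scheme.IsExcellent X'' :=
    isExcellent_of_locallyOfFiniteType_of_isExcellentRing hR (π ≫ q)
  have hJ : I.comap π ≠ ⊥ := by
    -- `π` is an isomorphism over the dense open `U₀`; `U = Reg S` is a non-empty open, so some
    -- point of `X''` maps into `U`, i.e. outside `Supp I = Uᶜ`; but `Supp (I.comap π) = ⊤`.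
    intro h0
    obtain ⟨U₀, hU₀d, -, hU₀iso⟩ := hπ.isBirational
    have hne : ((U : Set S) ∩ (U₀ : Set S)).Nonempty :=
      hU₀d.inter_open_nonempty _ U.isOpen ⟨genericPoint S, by
        rw [hU]; exact genericPoint_mem_regularLocus S⟩
    obtain ⟨s, hsU, hsU₀⟩ := hne
    haveI := hU₀iso
    obtain ⟨z, hz⟩ := (ConcreteCategory.bijective_of_isIso (π ∣_ U₀).base).2 ⟨s, hsU₀⟩
    have hπz : π ((π ⁻¹ᵁ U₀).ι z) = s := by
      have := morphismRestrict_base_coe π U₀ z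
      rw [hz] at this
      exact this.symm
    have hmem : (π ⁻¹ᵁ U₀).ι z ∈ ((I.comap π).support : Set X'') := by
      rw [h0, Scheme.IdealSheafData.support_bot]; trivial
    rw [Scheme.IdealSheafData.support_comap] at hmem
    have hmem' : π ((π ⁻¹ᵁ U₀).ι z) ∈ (I.support : Set S) := hmem
    rw [hπz, hIsupp] at hmem'
    exact hmem' hsU
  have hdim'' : topologicalKrullDim X'' = 3 := by
    haveI : IsProper r := hr.isProper
    haveI : IsDominant r := (hr.isBirational' hJ).isDominant
    haveI : IsDominant π := hπ.isBirational.isDominant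
    apply le_antisymm
    · calc topologicalKrullDim X'' ≤ topologicalKrullDim S₁ :=
            Literature.AlgebraicGeometry.Motives.Scheme.topologicalKrullDim_le_of_universallyClosed_of_surjective r
        _ ≤ 3 := hb.topologicalKrullDim_le_of_isLocallyNoetherian hdim.le
    · calc (3 : WithBot ℕ∞) = topologicalKrullDim S := hdim.symm
        _ ≤ topologicalKrullDim X'' :=
            Literature.AlgebraicGeometry.Motives.Scheme.topologicalKrullDim_le_of_universallyClosed_of_surjective π
  -- one `V(I𝒪_{X''})`-supported blow-up `σ : Xr → X''` with regular source principalizing `I𝒪_{X''}`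
  -- (CP 2019 Prop. 4.4 in blow-up format), factored through `r`
  obtain ⟨Q, Xr, σ, hQ, hσ, hXr, hcart⟩ :=
    Summit.ResolutionOfSingularities.ResolutionOfSingularities.Theorems.formatPrincipalization_dim3_of_cossartPiltant
      hPr X'' hπ.isRegular hexc hdim'' (I.comap π) hJ
  obtain ⟨t, ht, htr⟩ := exists_isBlowup_factor hσ hr hcart
  -- `t ≫ b` is a `Sing S`-supported blow-up with regular source
  have hIT : (I.support : Set S) ⊆ (Scheme.regularLocus S)ᶜ := by rw [hIsupp, hU]
  have hQT : ((Q.comap r).support : Set S₁) ⊆ b ⁻¹' (Scheme.regularLocus S)ᶜ := by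
    intro s hs
    rw [Scheme.IdealSheafData.support_comap] at hs
    have hs' : π (r s) ∈ (I.support : Set S) := by
      have := hQ hs
      rwa [Scheme.IdealSheafData.support_comap] at this
    rw [← hIsupp, Set.mem_preimage, ← hrb, Scheme.Hom.comp_apply] at *
    exact hIT hs'
  obtain ⟨Q₂, hcomp, hQ₂⟩ := hb.exists_isBlowup_comp_supported b I t (Q.comap r) _ hIT ht hQT
  exact ⟨Xr, t ≫ b, ⟨Q₂, hcomp, hQ₂⟩, hXr⟩

/-! ## Cossart–Piltant 2008/2009 over perfect fields, for closed subschemes of `ℙⁿ_k` -/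

/-- **A perfect field is differentially finite over itself**: with `k₀ := k`, `Ω_{k/k} = 0` is a finite `k`-module
(Cossart–Piltant 2008, hypothesis of Thm. 2.1: "`k` differentially finite over a perfect field `k₀`").
[cite: CossartPiltant2008, Thm 2.1 (HAL p. 3)] -/
theorem isDifferentiallyFinite_of_perfectField (k : Type u) [Field k] [PerfectField k] :
    CP2008.IsDifferentiallyFinite k := by
  refine ⟨k, inferInstance, Algebra.id k, ‹PerfectField k›, ?_⟩
  haveI : Subsingleton (Ω[k⁄k]) :=
    KaehlerDifferential.subsingleton_of_surjective k k Function.surjective_id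
  exact Module.Finite.of_surjective (0 : k →ₗ[k] Ω[k⁄k]) fun x => ⟨0, Subsingleton.elim _ _⟩

/-- **Cossart–Piltant 2008 Thm. 2.1 / 2009 "Theorem" for a reduced closed subscheme `H ⊆ ℙⁿ_k` of dimension three**
(`k` differentially finite of characteristic `p > 0`): a resolution `π : X' → H` (proper — indeed projective —,
birational, `X'` regular) which is an isomorphism over the open `Reg H`.  `H` is quasi-projective over `k` through the
closed immersion; birationality from clause (iii) (the exceptional locus is an SNC divisor, so `π⁻¹(Reg H)` is dense,
`IsStrictNormalCrossingsDivisor.dense_compl`, `isBirational_of_isIso_restrict`), exactly as in the tree's affine rendering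
`CP2008.exists_isResolution_of_resolutionQuasiProjectiveThreefolds`.
[cite: CossartPiltant2008, Thm 2.1 (HAL p. 3)] [cite: CossartPiltant2009, Theorem (p. 1839)] -/
theorem exists_isResolution_of_resolutionQuasiProjectiveThreefolds_of_isClosedImmersion
    (h : CP2008.ResolutionQuasiProjectiveThreefolds.{u}) {p : ℕ} [Fact p.Prime] {k : Type u} [Field k] [CharP k p]
    (hk : CP2008.IsDifferentiallyFinite k) {n : ℕ} {H : Scheme.{u}} [IsReduced H]
    (ι : H ⟶ (projectiveSpace n k).left) [IsClosedImmersion ι] (hdim : topologicalKrullDim H = 3) :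
    ∃ (X' : Scheme.{u}) (π : X' ⟶ H), IsResolution π ∧
      ∃ U : H.Opens, (U : Set H) = Scheme.regularLocus H ∧ IsIso (π ∣_ U) := by
  have hqp : CP2008.IsQuasiProjectiveOver (ι ≫ (projectiveSpace n k).hom) := ⟨n, ι, inferInstance, rfl⟩
  obtain ⟨Z', π, hproj, hreg, ⟨U, hU, hiso⟩, hsnc⟩ := h p k hk H (ι ≫ (projectiveSpace n k).hom) hqp hdim
  haveI := hiso
  haveI : IsProper π := hproj.isProper
  have hd : Dense ((π ⁻¹ᵁ U : Z'.Opens) : Set Z') := by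
    have := hsnc.dense_compl
    rw [Set.preimage_compl, compl_compl, ← hU] at this
    exact this
  exact ⟨Z', π, ⟨‹_›, isBirational_of_isIso_restrict π U hU.ge hd, hreg⟩, U, hU, hiso⟩

/-! ## The `n = 4` leaf of the line, conditional on ONE printed theorem -/

/-- **The `n = 4` leaf `stub_blowupModel_four` CONDITIONAL on Cossart–Piltant 2008 Thm. 2.1 / 2009 "Theorem" alone**
(`CP2008.ResolutionQuasiProjectiveThreefolds.{0}`; after this binder the type is the registered signature verbatim).  For an
integral closed `H ⊆ ℙ⁴_k` with locally principal ideal, `k = k̄` of characteristic `p`: if `ι` is an isomorphism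
`H ≅ ℙ⁴_k` is regular and `𝔞 = ⊤`; otherwise `H` is an integral hypersurface of dimension `3`
(`topologicalKrullDim_of_hypersurface`), `k` is perfect hence differentially finite, CP 2008 gives a resolution which is
an isomorphism over `Reg H`, the engine `admitsDesingularization_of_isResolution_dim_three` (with Prop. 4.4 DISCHARGED,
`CP2008Prop44.CossartPiltant2019Principalization_holds`) gives one `Sing H`-supported blow-up with regular source, which
is a regular blow-up model (`blowupModel_of_admitsDesingularization`).
[cite: CossartPiltant2008, Thm 2.1 (HAL p. 3)] [cite: CossartPiltant2009, Theorem (p. 1839)]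
[cite: CossartPiltant2019, Prop. 4.4] [cite: StacksProject, Tag 081T; Tag 080B] -/
theorem stub_blowupModel_four_of_CP2008 (h2008 : CP2008.ResolutionQuasiProjectiveThreefolds.{0}) : ∀ p : ℕ, p.Prime → ∀ (k : Type) [Field k] [CharP k p] [IsAlgClosed k] (n : ℕ) (H : AlgebraicGeometry.Scheme.{0}) (ι : H ⟶ (Literature.AlgebraicGeometry.Motives.projectiveSpace n k).left), AlgebraicGeometry.IsClosedImmersion ι → AlgebraicGeometry.IsIntegral H → (∀ y : (Literature.AlgebraicGeometry.Motives.projectiveSpace n k).left, ∃ U : (Literature.AlgebraicGeometry.Motives.projectiveSpace n k).left.affineOpens, y ∈ (U : (Literature.AlgebraicGeometry.Motives.projectiveSpace n k).left.Opens) ∧ (ι.ker.ideal U).IsPrincipal) → n = 4 → ∃ 𝔞 : H.IdealSheafData, 𝔞 ≠ ⊥ ∧ ∀ (Z : AlgebraicGeometry.Scheme.{0}) (π : Z ⟶ H), Literature.AlgebraicGeometry.Resolution.IsBlowup π 𝔞 → Literature.AlgebraicGeometry.Resolution.Scheme.IsRegular Z := by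
  intro p hp k _ _ _ n H ι hι hH hloc hn
  subst hn
  by_cases hiso : IsIso ι
  · -- `H = ℙ⁴_k` is regular
    exact exists_blowupModel_of_isRegular
      (Scheme.IsRegular.of_iso (inv ι) (isRegular_projectiveSpace 4 k))
  · -- `H` is an integral hypersurface of dimension `3`: Cossart–Piltant 2008/2009
    have hdim : topologicalKrullDim H = 3 := by
      rw [topologicalKrullDim_of_hypersurface (n := 3) ι hloc hiso]; rfl
    haveI : IsProper (projectiveSpace 4 k).hom := isProper_projectiveSpace 4 k
    haveI : Fact p.Prime := ⟨hp⟩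
    obtain ⟨X'', π, hπ, U, hU, hisoU⟩ :=
      exists_isResolution_of_resolutionQuasiProjectiveThreefolds_of_isClosedImmersion h2008
        (isDifferentiallyFinite_of_perfectField k) ι hdim
    haveI := hisoU
    exact blowupModel_of_admitsDesingularization
      (admitsDesingularization_of_isResolution_dim_three
        Summit.ResolutionOfSingularities.ResolutionOfSingularities.Theorems.CP2008Prop44.CossartPiltant2019Principalization_holds
        (isExcellentRing_of_field k) H (ι ≫ (projectiveSpace 4 k).hom) hdim π hπ U hU)

/-- **The `n = 4` leaf CONDITIONAL on `CossartPiltant2019General.{0}` ALONE** (Cossart–Piltant 2019 Thm. 1.1 (i)(ii); Prop. 4.4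
folded in through its discharge `CP2008Prop44.CossartPiltant2019Principalization_holds`): `stub_blowupModel_four_of_CP`.
[cite: CossartPiltant2019, Thm. 1.1 (i)(ii); Prop. 4.4] -/
theorem stub_blowupModel_four_of_CP2019General (hCP : CossartPiltant2019General.{0}) : ∀ p : ℕ, p.Prime → ∀ (k : Type) [Field k] [CharP k p] [IsAlgClosed k] (n : ℕ) (H : AlgebraicGeometry.Scheme.{0}) (ι : H ⟶ (Literature.AlgebraicGeometry.Motives.projectiveSpace n k).left), AlgebraicGeometry.IsClosedImmersion ι → AlgebraicGeometry.IsIntegral H → (∀ y : (Literature.AlgebraicGeometry.Motives.projectiveSpace n k).left, ∃ U : (Literature.AlgebraicGeometry.Motives.projectiveSpace n k).left.affineOpens, y ∈ (U : (Literature.AlgebraicGeometry.Motives.projectiveSpace n k).left.Opens) ∧ (ι.ker.ideal U).IsPrincipal) → n = 4 → ∃ 𝔞 : H.IdealSheafData, 𝔞 ≠ ⊥ ∧ ∀ (Z : AlgebraicGeometry.Scheme.{0}) (π : Z ⟶ H), Literature.AlgebraicGeometry.Resolution.IsBlowup π 𝔞 → Literature.AlgebraicGeometry.Resolution.Scheme.IsRegular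 Z :=
  stub_blowupModel_four_of_CP hCP
    Summit.ResolutionOfSingularities.ResolutionOfSingularities.Theorems.CP2008Prop44.CossartPiltant2019Principalization_holds

/-- **The `n = 4` leaf CONDITIONAL on the single port fact `CP2019.CossartPiltant2019Thm11.{0}`** (Cossart–Piltant 2019
Thm. 1.1 with its SNC clause (iii), the tree's sharp sibling; `CP2019.CossartPiltant2019Thm11.general`).
[cite: CossartPiltant2019, Thm. 1.1] -/
theorem stub_blowupModel_four_of_CP2019Thm11 (h11 : CP2019.CossartPiltant2019Thm11.{0}) : ∀ p : ℕ, p.Prime → ∀ (k : Type) [Field k] [CharP k p] [IsAlgClosed k] (n : ℕ) (H : AlgebraicGeometry.Scheme.{0}) (ι : H ⟶ (Literature.AlgebraicGeometry.Motives.projectiveSpace n k).left), AlgebraicGeometry.IsClosedImmersion ι → AlgebraicGeometry.IsIntegral H → (∀ y : (Literature.AlgebraicGeometry.Motives.projectiveSpace n k).left, ∃ U : (Literature.AlgebraicGeometry.Motives.projectiveSpace n k).left.affineOpens, y ∈ (U : (Literature.AlgebraicGeometry.Motives.projectiveSpace n k).left.Opens) ∧ (ι.ker.ideal U).IsPrincipal)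 → n = 4 → ∃ 𝔞 : H.IdealSheafData, 𝔞 ≠ ⊥ ∧ ∀ (Z : AlgebraicGeometry.Scheme.{0}) (π : Z ⟶ H), Literature.AlgebraicGeometry.Resolution.IsBlowup π 𝔞 → Literature.AlgebraicGeometry.Resolution.Scheme.IsRegular Z :=
  stub_blowupModel_four_of_CP2019General h11.general

end Summit.ResolutionOfSingularities.ResolutionOfSingularities.Cruxes.EquisingularLift.StrataSplit

end
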